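import Mathlib
import Literature.MathematicalPhysics.StatisticalMechanics.Crystallization
import Literature.MathematicalPhysics.StatisticalMechanics.LennardJonesClusters
import Literature.MathematicalPhysics.StatisticalMechanics.PeriodicConfigurationSums
import Summits.AtomisticToContinuum.Crystallization.Theses.ThreeConeCertificate
import Summits.AtomisticToContinuum.Crystallization.Theorems.ThreeConeCertificateExactCertificateTransfer1DCore
import Summits.AtomisticToContinuum.Crystallization.Theorems.ThreeConeCertificateExactCertificateTransfer1DChain
import Summits.AtomisticToContinuum.Crystallization.Theorems.ThreeConeCertificateExactCertificateTransfer1DCrossing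
import Summits.AtomisticToContinuum.Crystallization.Theorems.ThreeConeCertificateExactCertificateTransfer1DPsiPosType
import Summits.AtomisticToContinuum.Crystallization.Theorems.ThreeConeCertificateExactCertificateTransfer1DMatern
import Summits.AtomisticToContinuum.Crystallization.Theorems.ThreeConeCertificateExactCertificateTransfer1DPosType
import Summits.AtomisticToContinuum.Crystallization.Theorems.ThreeConeCertificateExactCertificateTransfer1DTail
import Summits.AtomisticToContinuum.Crystallization.Theorems.ThreeConeCertificateExactCertificateTransfer1DGenerator
import Summits.AtomisticToContinuum.Crystallization.Theorems.ThreeConeCertificateExactCertificateTransfer1DChainEnergy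
import Summits.AtomisticToContinuum.Crystallization.Theorems.ThreeConeCertificateExactCertificateTransfer1DCesaro
import Summits.AtomisticToContinuum.Crystallization.Theorems.ThreeConeCertificateExactCertificateTransfer1DPeriodicPosType

/-!
# Crux `ExactCertificate` (stmt-AtomisticToContinuum-11959), line `closure-makes-nogap-exact`, lead c6:
# TRANSFER skeleton — the d = 1 exact certificate `ExactCertificate1D`

Skeleton v4 (c6, 2026-08-17) — SORRY-FREE: all eleven stubs landed (wave 2: stub_latticeGenerator1D p138629, stub_cesaro p138630, stub_chainEnergy p138720, stub_periodicPosType1D p139123; deciding theorem landed p139300 `Theorems/ThreeConeCertificateExactCertificateTransfer1D.lean`).  History: v3: ALL seven wave-1 stubs LANDED (stub_coreOf p137984, stub_chain p137999, stub_crossing p138012, stub_psiPosTypeOf p138087, stub_quadAntitone p138157, stub_posTypeOfPsi p138180, stub_tailFzero p138380) and imported — `ExactCertificate1D_proof` and `keplerBound1D` are sorry-free; wave 2 (4 stubs: stub_latticeGenerator1D, stub_chainEnergy, stub_cesaro, stub_periodicPosType1D) composes the ENERGETIC statement `HasPeriodicGroundStateEnergy lennardJones 1` (`hasPeriodicGroundStateEnergy_one_proof`).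  The 3-D line is parked where c5 left it (skeleton v6 of
`Lines/closure_makes_nogap_exact.lean`: stubs `stub_noGap` = SharpSplit, `stub_periodicMinimum` = KeplerBound =
item 11961 ↔ 0627; both item-level).  This file is the seat's movement: the d = 1 analogue of the crux
(`ExactCertificate1D`, the crux with `3 ↦ 1`, typed by the crux strategist in `Cruxes/ExactCertificate/Transfer1D.lean`)
PROVED modulo ≤ 7 registered stubs, with a STRUCTURAL proof of the two analytic inputs the census could only certify
numerically.

Construction (a > 0 the zero-pressure lattice constant, `a⁶ = ζ(12)/ζ(6)`; `V = lennardJones = r⁻¹²/12 − r⁻⁶/6`):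

  F_a(x) := Σ_{k≥0} (k+1)·[V(|x+a|+(k+1)a) − 2V(|x|+(k+1)a) + V(|x−a|+(k+1)a)]   (= −¼Δ_a Ψ_a, Ψ_a(x) = −4Σ(k+1)V(|x|+(k+1)a))
  g := (V − F_a)·1_{(0,a)},  U :≡ 0,  c := 0,  ρ := a,  P := aℤ.

Mechanism: `−V(r) = ∫₀^∞ e^{−tr} p(t) dt` with `p(t) = t⁵/6! − t¹¹/12!` (ONE sign change, at t₀⁶ = 12!/6!), and
zero pressure is `Σ_k (k+1) ∫₀^∞ e^{−t(k+1)a} t·p(t) dt = Σ_k (k+1)[((k+1)a)⁻⁷ − ((k+1)a)⁻¹³] = 0`.  Hence for every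
ANTITONE `h` on `(0,∞)`: `Σ_k (k+1) ∫ e^{−t(k+1)a} p(t)·t·h(t) dt ≥ 0` (the integrand of `…·(h(t) − h(t₀))` is ≥ 0
pointwise) — `stub_crossing`.  With `h(t) = Q(t)/t`, `Q(t) = Σ_{ij} w_i w_j e^{−t|x_i−x_j|}` (antitone because
`−t²(Q/t)' = Σ w_i w_j (1+t|δ|)e^{−t|δ|}` is a Matérn-3/2 Gram form ≥ 0 — `stub_quadAntitone`) this gives `Ψ_a` of positive
type (`stub_psiPosTypeOf`) and then `F_a` by the doubling trick (`stub_posTypeOfPsi`); with `h(t) = −sinh(tu)/t` it gives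
`V − F_a = Σ_{m≥1} m[V(ma−u) − V(ma+u)] ≥ 0` on `(0,a)`, `u = a − r` (`stub_coreOf`).  `F_a = V` on `[a,∞)` and
`F_a(0) = −2Σ_{m≥1}V(ma)` are telescoping identities (`stub_tailFzero`); `e_V(aℤ) = Σ_{m≥1} V(ma)` (`stub_chain`).
-/

noncomputable section

namespace Summit.AtomisticToContinuum.Crystallization.Cruxes.ExactCertificate.Transfer1D

open Literature.MathematicalPhysics.StatisticalMechanics MeasureTheory Set
open scoped BigOperators
-- LANDED stubs (Theorems/ThreeConeCertificateExactCertificateTransfer1D{Core,Chain,Crossing,PsiPosType,Matern,PosType}.lean: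
-- stub_coreOf p137984, stub_chain p137999, stub_crossing p138012, stub_psiPosTypeOf p138087, stub_quadAntitone p138157,
-- stub_posTypeOfPsi p138180, stub_tailFzero p138380) — wave 1 COMPLETE; wave 2 LANDED (Generator p138629, Cesaro p138630,
-- ChainEnergy p138720, PeriodicPosType p139123): this skeleton is now SORRY-FREE; its deciding theorem landed as
-- Theorems/ThreeConeCertificateExactCertificateTransfer1D.lean (p139300, registered sub-goal `exactCertificate1D`).
open Summit.AtomisticToContinuum.Crystallization.Theorems.ThreeConeCertificateExactCertificate.Transfer1D
  (stub_chain stub_crossing stub_coreOf stub_psiPosTypeOf stub_quadAntitone stub_posTypeOfPsi stub_tailFzero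
   stub_latticeGenerator1D stub_chainEnergy stub_cesaro stub_periodicPosType1D summable_mul_lennardJones_of_le)

/-- The d = 1 analogue of `ThreeConeCertificate.ExactCertificate`: the crux with `3 ↦ 1`, verbatim otherwise
(identical to the strategist's `Transfer1D.ExactCertificate1D`). -/
def ExactCertificate1D : Prop :=
  ∃ (P : PeriodicConfiguration 1) (ρ c : ℝ) (g U f : ℝ → ℝ),
    (∀ r : ℝ, 0 < r → lennardJones r = g r + U r + f r) ∧ (∀ r : ℝ, 0 < r → 0 ≤ U r) ∧
    (∀ r : ℝ, ρ ≤ r → g r = 0) ∧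
    (∀ (n : ℕ) (y : Fin n → EuclideanSpace ℝ (Fin 1)) (w : Fin n → ℝ),
      0 ≤ ∑ i, ∑ j, w i * w j * f (dist (y i) (y j))) ∧
    (∀ (N : ℕ) (x : Fin N → EuclideanSpace ℝ (Fin 1)), Function.Injective x →
      -(c * (N : ℝ)) ≤ interactionEnergy g x) ∧
    c + f 0 / 2 = -(P.energyPerParticle lennardJones)

/-! ## Proved here: zero pressure, and the composition -/

/-- ZERO PRESSURE: there is `a > 0` (namely `a⁶ = ζ(12)/ζ(6)`, `a ≈ 0.99718`) with
`Σ_{k≥0} (k+1)·[((k+1)a)⁻⁷ − ((k+1)a)⁻¹³] = 0`, i.e. `Σ_{m≥1} m V′(ma) = 0`. -/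
theorem zeroPressure_exists : ∃ a : ℝ, 0 < a ∧
    HasSum (fun k : ℕ => ((k : ℝ) + 1) * ((((k : ℝ) + 1) * a)⁻¹ ^ 7 - (((k : ℝ) + 1) * a)⁻¹ ^ 13)) 0 := by
  -- the two zeta values as sums over `k + 1`
  have hs6 : Summable (fun k : ℕ => ((k : ℝ) + 1)⁻¹ ^ 6) := by
    have h := (Real.summable_nat_pow_inv.2 (by norm_num : 1 < 6))
    have h' := (summable_nat_add_iff 1).2 h
    refine h'.congr fun k => ?_
    push_cast
    rw [inv_pow]
  have hs12 : Summable (fun k : ℕ => ((k : ℝ) + 1)⁻¹ ^ 12) := by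
    have h := (Real.summable_nat_pow_inv.2 (by norm_num : 1 < 12))
    have h' := (summable_nat_add_iff 1).2 h
    refine h'.congr fun k => ?_
    push_cast
    rw [inv_pow]
  set Z6 : ℝ := ∑' k : ℕ, ((k : ℝ) + 1)⁻¹ ^ 6 with hZ6
  set Z12 : ℝ := ∑' k : ℕ, ((k : ℝ) + 1)⁻¹ ^ 12 with hZ12
  have hZ6pos : 0 < Z6 := by
    have h1 : (0 : ℝ) < ((0 : ℕ) : ℝ) + 1 := by norm_num
    have := hs6.hasSum
    refine lt_of_lt_of_le (by positivity : (0:ℝ) < ((((0:ℕ) : ℝ) + 1)⁻¹ ^ 6)) ?_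
    exact le_hasSum this 0 fun k _ => by positivity
  have hZ12pos : 0 < Z12 := by
    refine lt_of_lt_of_le (by positivity : (0:ℝ) < ((((0:ℕ) : ℝ) + 1)⁻¹ ^ 12)) ?_
    exact le_hasSum hs12.hasSum 0 fun k _ => by positivity
  -- the lattice constant
  set a : ℝ := (Z12 / Z6) ^ ((1 : ℝ) / 6) with ha
  have hapos : 0 < a := Real.rpow_pos_of_pos (div_pos hZ12pos hZ6pos) _
  have ha6 : a ^ 6 = Z12 / Z6 := by
    rw [ha, ← Real.rpow_natCast, ← Real.rpow_mul (div_pos hZ12pos hZ6pos).le]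
    norm_num
  refine ⟨a, hapos, ?_⟩
  -- termwise: (k+1)·((k+1)a)⁻⁷ = a⁻⁷ (k+1)⁻⁶ and (k+1)·((k+1)a)⁻¹³ = a⁻¹³ (k+1)⁻¹²
  have hterm : ∀ k : ℕ, ((k : ℝ) + 1) * ((((k : ℝ) + 1) * a)⁻¹ ^ 7 - (((k : ℝ) + 1) * a)⁻¹ ^ 13)
      = a⁻¹ ^ 7 * ((k : ℝ) + 1)⁻¹ ^ 6 - a⁻¹ ^ 13 * ((k : ℝ) + 1)⁻¹ ^ 12 := by
    intro k
    have hk : (k : ℝ) + 1 ≠ 0 := by positivity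
    have hane : a ≠ 0 := hapos.ne'
    rw [mul_inv, mul_pow, mul_pow]
    field_simp
  have hsum : HasSum (fun k : ℕ => a⁻¹ ^ 7 * ((k : ℝ) + 1)⁻¹ ^ 6 - a⁻¹ ^ 13 * ((k : ℝ) + 1)⁻¹ ^ 12)
      (a⁻¹ ^ 7 * Z6 - a⁻¹ ^ 13 * Z12) :=
    (hs6.hasSum.mul_left _).sub (hs12.hasSum.mul_left _)
  have hval : a⁻¹ ^ 7 * Z6 - a⁻¹ ^ 13 * Z12 = 0 := by
    have hZ6ne : Z6 ≠ 0 := hZ6pos.ne'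
    have hane : a ≠ 0 := hapos.ne'
    have h12 : Z12 = a ^ 6 * Z6 := by rw [ha6]; field_simp
    rw [h12]
    field_simp
    ring
  rw [hval] at hsum
  simpa only [hterm] using hsum

/-- THE d = 1 EXACT CERTIFICATE, composed from the stubs: `ρ = a`, `c = 0`, `g = (V − F_a)1_{(0,a)}`, `U = 0`, `f = F_a`. -/
theorem ExactCertificate1D_proof : ExactCertificate1D := by
  obtain ⟨a, ha, hz⟩ := zeroPressure_exists
  obtain ⟨P, hP⟩ := stub_chain a ha
  obtain ⟨htail, hF0⟩ := stub_tailFzero a ha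
  -- the tail interpolant `F_a`
  set Fa : ℝ → ℝ := fun x => ∑' k : ℕ, ((k : ℝ) + 1) * (lennardJones (|x + a| + ((k : ℝ) + 1) * a)
      - 2 * lennardJones (|x| + ((k : ℝ) + 1) * a) + lennardJones (|x - a| + ((k : ℝ) + 1) * a)) with hFa
  have hFa_tail : ∀ x : ℝ, a ≤ x → Fa x = lennardJones x := fun x hx => htail x hx
  have hFa_zero : Fa 0 = -2 * ∑' k : ℕ, lennardJones (((k : ℝ) + 1) * a) := by
    rw [← hF0, hFa]
    simp only [zero_add, zero_sub, abs_neg, abs_zero, abs_of_pos ha]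
  have hcore : ∀ r : ℝ, 0 < r → r < a → Fa r ≤ lennardJones r :=
    fun r hr hra => stub_coreOf stub_crossing a ha hz r hr hra
  have hpos : ∀ (n : ℕ) (y : Fin n → EuclideanSpace ℝ (Fin 1)) (w : Fin n → ℝ),
      0 ≤ ∑ i, ∑ j, w i * w j * Fa (dist (y i) (y j)) :=
    stub_posTypeOfPsi a ha (stub_psiPosTypeOf stub_quadAntitone stub_crossing a ha hz)
  refine ⟨P, a, 0, fun r => if r < a then lennardJones r - Fa r else 0, fun _ => 0, Fa,
    ?_, fun _ _ => le_rfl, ?_, hpos, ?_, ?_⟩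
  · -- (S1) the split on (0,∞)
    intro r _
    show lennardJones r = (if r < a then lennardJones r - Fa r else 0) + 0 + Fa r
    by_cases h : r < a
    · rw [if_pos h]; ring
    · rw [if_neg h, hFa_tail r (not_lt.1 h)]; ring
  · -- (S3) finite range `ρ = a`
    intro r hr
    show (if r < a then lennardJones r - Fa r else 0) = 0
    rw [if_neg (not_lt.2 hr)]
  · -- (S5) `0`-stability: `g ≥ 0` pair by pair
    intro N x hx
    rw [zero_mul, neg_zero]
    unfold interactionEnergy
    refine Finset.sum_nonneg fun i _ => Finset.sum_nonneg fun j hj => ?_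
    have hd : 0 < dist (x i) (x j) := dist_pos.2 fun heq => (Finset.mem_Ioi.1 hj).ne' (hx heq.symm)
    show 0 ≤ (if dist (x i) (x j) < a then lennardJones (dist (x i) (x j)) - Fa (dist (x i) (x j)) else 0)
    by_cases h : dist (x i) (x j) < a
    · rw [if_pos h]
      exact sub_nonneg.2 (hcore _ hd h)
    · rw [if_neg h]
  · -- (S6) the value: `0 + F_a(0)/2 = −e(aℤ)`
    rw [hP, hFa_zero]
    ring

/-- Consequence (the 1-D Kepler bound with the SHARP constant): some periodic configuration `P` of the line (the zero-pressure
chain `aℤ`) has `N·e_V(P) ≤ E_N(x)` for every `N` and every configuration `x` of `N` distinct points — two lines from the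
certificate (`E_V = E_g + E_F ≥ 0 − N·F(0)/2`). -/
theorem keplerBound1D : ∃ P : PeriodicConfiguration 1, ∀ (N : ℕ) (x : Fin N → EuclideanSpace ℝ (Fin 1)),
    Function.Injective x → (N : ℝ) * P.energyPerParticle lennardJones ≤ interactionEnergy lennardJones x := by
  obtain ⟨P, ρ, c, g, U, f, hsplit, hU, -, hpos, hstab, hval⟩ := ExactCertificate1D_proof
  refine ⟨P, fun N x hx => ?_⟩
  have hE : interactionEnergy lennardJones x =
      interactionEnergy g x + interactionEnergy U x + interactionEnergy f x := by
    unfold interactionEnergy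
    rw [← Finset.sum_add_distrib, ← Finset.sum_add_distrib]
    refine Finset.sum_congr rfl fun i _ => ?_
    rw [← Finset.sum_add_distrib, ← Finset.sum_add_distrib]
    refine Finset.sum_congr rfl fun j hj => ?_
    have hd : 0 < dist (x i) (x j) := dist_pos.2 fun heq => (Finset.mem_Ioi.1 hj).ne' (hx heq.symm)
    exact hsplit _ hd
  have hUE : 0 ≤ interactionEnergy U x := by
    unfold interactionEnergy
    refine Finset.sum_nonneg fun i _ => Finset.sum_nonneg fun j hj => hU _ ?_
    exact dist_pos.2 fun heq => (Finset.mem_Ioi.1 hj).ne' (hx heq.symm)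
  have hgE := hstab N x hx
  have hfE : -((N : ℝ) * f 0 / 2) ≤ interactionEnergy f x := by
    have h1 := hpos N x (fun _ => 1)
    simp only [one_mul] at h1
    have h2 : ∑ i, ∑ j, f (dist (x i) (x j)) = N * f 0 + 2 * interactionEnergy f x := by
      rw [two_mul_interactionEnergy]
      have h : ∀ i : Fin N, ∑ j, f (dist (x i) (x j)) = f 0 + siteEnergy f x i := fun i => by
        rw [siteEnergy, ← Finset.add_sum_erase Finset.univ _ (Finset.mem_univ i), dist_self]
      simp only [h, Finset.sum_add_distrib, Finset.sum_const, Finset.card_univ, Fintype.card_fin,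
        nsmul_eq_mul]
    rw [h2] at h1
    linarith
  have hv : P.energyPerParticle lennardJones = -(c + f 0 / 2) := by rw [hval]; ring
  rw [hv, hE]
  nlinarith [hgE, hUE, hfE]

/-! ## Wave 2 (extension): the ENERGETIC CRYSTALLIZATION statement in d = 1,
`HasPeriodicGroundStateEnergy lennardJones 1` (the d = 1 analogue of conjunct (i) of the summit), from the certificate
WITHOUT trial states for general periodic competitors: a periodic Bochner inequality instead. -/

/-- ENERGETIC CRYSTALLIZATION OF THE LENNARD-JONES CHAIN (composition of wave 1 + wave 2): the ground-state energy per
particle `E(N)/N` of `N` Lennard-Jones particles on a line converges to the MINIMUM of the energy per particle over all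
periodic configurations of `ℝ¹`, attained at the zero-pressure chain `aℤ` — `HasPeriodicGroundStateEnergy lennardJones 1`,
the d = 1 analogue of conjunct (i) of the summit sub-problem (open in d = 3). -/
theorem hasPeriodicGroundStateEnergy_one_proof : HasPeriodicGroundStateEnergy lennardJones 1 := by
  obtain ⟨a, ha, hz⟩ := zeroPressure_exists
  obtain ⟨P, hP⟩ := stub_chain a ha
  obtain ⟨htail, hF0⟩ := stub_tailFzero a ha
  set Fa : ℝ → ℝ := fun x => ∑' k : ℕ, ((k : ℝ) + 1) * (lennardJones (|x + a| + ((k : ℝ) + 1) * a)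
      - 2 * lennardJones (|x| + ((k : ℝ) + 1) * a) + lennardJones (|x - a| + ((k : ℝ) + 1) * a)) with hFa
  have hFa_tail : ∀ x : ℝ, a ≤ x → Fa x = lennardJones x := fun x hx => htail x hx
  have hFa_zero : Fa 0 = -2 * ∑' k : ℕ, lennardJones (((k : ℝ) + 1) * a) := by
    rw [← hF0, hFa]
    simp only [zero_add, zero_sub, abs_neg, abs_zero, abs_of_pos ha]
  have hcore : ∀ r : ℝ, 0 < r → r < a → Fa r ≤ lennardJones r :=
    fun r hr hra => stub_coreOf stub_crossing a ha hz r hr hra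
  have hpos : ∀ (n : ℕ) (y : Fin n → EuclideanSpace ℝ (Fin 1)) (w : Fin n → ℝ),
      0 ≤ ∑ i, ∑ j, w i * w j * Fa (dist (y i) (y j)) :=
    stub_posTypeOfPsi a ha (stub_psiPosTypeOf stub_quadAntitone stub_crossing a ha hz)
  -- `F_a ≤ V` on all of `(0,∞)`
  have hle : ∀ r : ℝ, 0 < r → Fa r ≤ lennardJones r := fun r hr => by
    by_cases h : r < a
    · exact hcore r hr h
    · exact (hFa_tail r (not_lt.1 h)).le
  have heP : P.energyPerParticle lennardJones = -(Fa 0 / 2) := by rw [hP, hFa_zero]; ring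
  -- (1) `e(P) ≤ e(Q)` for every periodic `Q`: periodic Bochner + monotonicity
  have hleast : ∀ Q : PeriodicConfiguration 1,
      P.energyPerParticle lennardJones ≤ Q.energyPerParticle lennardJones := by
    intro Q
    have hsV : ∀ y : EuclideanSpace ℝ (Fin 1), y ∈ Q.points →
        Summable (fun z : {z : EuclideanSpace ℝ (Fin 1) // z ∈ Q.points ∧ z ≠ y} =>
          lennardJones (dist y z.1)) :=
      fun y _ => Q.summable_lennardJones_dist (by norm_num) y
    -- `F_a`-sites differ from `V`-sites only at the finitely many points within distance `a`
    have hsF : ∀ y : EuclideanSpace ℝ (Fin 1), y ∈ Q.points →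
        Summable (fun z : {z : EuclideanSpace ℝ (Fin 1) // z ∈ Q.points ∧ z ≠ y} => Fa (dist y z.1)) := by
      intro y hy
      have hfin : (Function.support fun z : {z : EuclideanSpace ℝ (Fin 1) // z ∈ Q.points ∧ z ≠ y} =>
          Fa (dist y z.1) - lennardJones (dist y z.1)).Finite := by
        have h1 := Q.finite_inter_points (Metric.isBounded_closedBall (x := y) (r := a))
        refine ((h1.preimage Subtype.val_injective.injOn)).subset fun z hz => ?_
        refine ⟨Metric.mem_closedBall'.2 ?_, z.2.1⟩
        by_contra hlt
        exact hz (show Fa (dist y z.1) - lennardJones (dist y z.1) = 0 by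
          rw [hFa_tail _ (not_le.1 hlt).le, sub_self])
      have h2 : Summable (fun z : {z : EuclideanSpace ℝ (Fin 1) // z ∈ Q.points ∧ z ≠ y} =>
          Fa (dist y z.1) - lennardJones (dist y z.1)) := summable_of_hasFiniteSupport hfin
      simpa using h2.add (hsV y hy)
    have hB := stub_periodicPosType1D stub_latticeGenerator1D stub_cesaro Q Fa hpos hsF
    have hmono : Q.energyPerParticle Fa ≤ Q.energyPerParticle lennardJones := by
      unfold PeriodicConfiguration.energyPerParticle
      refine mul_le_mul_of_nonneg_left (Finset.sum_le_sum fun y hy => ?_) (by positivity)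
      have hyP := Q.mem_points_of_mem_motif hy
      exact (hsF y hyP).tsum_le_tsum (fun z => hle _ (dist_pos.2 fun h => z.2.2 h.symm)) (hsV y hyP)
    linarith
  -- (2) `E(N)/N → e(P)`: squeeze between the Kepler bound and the equally spaced trial state
  have hlower : ∀ N : ℕ, 0 < N →
      P.energyPerParticle lennardJones ≤ groundStateEnergy lennardJones 1 N / N := by
    intro N hN
    have hNr : (0 : ℝ) < N := by exact_mod_cast hN
    rw [le_div_iff₀ hNr, mul_comm]
    haveI : Nonempty {x : Fin N → EuclideanSpace ℝ (Fin 1) // Function.Injective x} :=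
      let ⟨x, hx⟩ := nonempty_injective_config (d := 1) one_pos N; ⟨⟨x, hx⟩⟩
    refine le_ciInf fun x => ?_
    -- `N e(P) = −N F(0)/2 ≤ E_F(x) ≤ E_V(x)`
    have hFE : -((N : ℝ) * Fa 0 / 2) ≤ interactionEnergy Fa x.1 := by
      have h1 := hpos N x.1 (fun _ => 1)
      simp only [one_mul] at h1
      have h2 : ∑ i, ∑ j, Fa (dist (x.1 i) (x.1 j)) = N * Fa 0 + 2 * interactionEnergy Fa x.1 := by
        rw [two_mul_interactionEnergy]
        have h : ∀ i : Fin N, ∑ j, Fa (dist (x.1 i) (x.1 j)) = Fa 0 + siteEnergy Fa x.1 i := fun i => by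
          rw [siteEnergy, ← Finset.add_sum_erase Finset.univ _ (Finset.mem_univ i), dist_self]
        simp only [h, Finset.sum_add_distrib, Finset.sum_const, Finset.card_univ, Fintype.card_fin,
          nsmul_eq_mul]
      rw [h2] at h1
      linarith
    have hVF : interactionEnergy Fa x.1 ≤ interactionEnergy lennardJones x.1 := by
      unfold interactionEnergy
      refine Finset.sum_le_sum fun i _ => Finset.sum_le_sum fun j hj => hle _ ?_
      exact dist_pos.2 fun heq => (Finset.mem_Ioi.1 hj).ne' (x.2 heq.symm)
    rw [heP]
    linarith
  have hupper : ∀ N : ℕ, 0 < N → groundStateEnergy lennardJones 1 N / N ≤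
      (∑ d ∈ Finset.range N, ((N : ℝ) - d) * lennardJones (d * a)) / N := by
    intro N hN
    have hNr : (0 : ℝ) < N := by exact_mod_cast hN
    obtain ⟨hinj, hE⟩ := stub_chainEnergy a ha N
    rw [← hE]
    exact div_le_div_of_nonneg_right (groundStateEnergy_lennardJones_le hinj) hNr.le
  have htend : Filter.Tendsto (fun N : ℕ => groundStateEnergy lennardJones 1 N / N) Filter.atTop
      (nhds (P.energyPerParticle lennardJones)) := by
    -- the trial-state energies per particle converge to `Σ_{d≥0} V(da) = Σ_{m≥1} V(ma) = e(P)`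
    have hs1 : Summable (fun k : ℕ => lennardJones (((k : ℝ) + 1) * a)) := by
      have hw := summable_mul_lennardJones_of_le
        ha (fun k : ℕ => ((k : ℝ) + 1) * a) (fun k => le_rfl)
      refine Summable.of_norm_bounded hw.norm fun k => ?_
      rw [Real.norm_eq_abs, Real.norm_eq_abs, abs_mul, abs_of_pos (by positivity : (0 : ℝ) < (k : ℝ) + 1)]
      exact le_mul_of_one_le_left (abs_nonneg _) (by linarith [(k.cast_nonneg : (0 : ℝ) ≤ k)])
    have hs0 : Summable (fun d : ℕ => lennardJones ((d : ℝ) * a)) := by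
      refine (summable_nat_add_iff 1).1 (hs1.congr fun k => ?_)
      push_cast
      rfl
    have hc := stub_cesaro _ hs0
    have hsum0 : ∑' d : ℕ, lennardJones ((d : ℝ) * a) = P.energyPerParticle lennardJones := by
      rw [hP, hs0.tsum_eq_zero_add]
      simp only [Nat.cast_zero, zero_mul, lennardJones_zero, zero_add]
      push_cast
      rfl
    rw [hsum0] at hc
    refine tendsto_of_tendsto_of_tendsto_of_le_of_le' tendsto_const_nhds hc ?_ ?_
    · exact Filter.eventually_atTop.2 ⟨1, fun N hN => hlower N hN⟩
    · exact Filter.eventually_atTop.2 ⟨1, fun N hN => hupper N hN⟩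
  exact ⟨P, ⟨⟨P, rfl⟩, by rintro _ ⟨Q, rfl⟩; exact hleast Q⟩, htend⟩

end Summit.AtomisticToContinuum.Crystallization.Cruxes.ExactCertificate.Transfer1D

end
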